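import Summits.BirchSwinnertonDyer.BirchSwinnertonDyer.Theorems.KatoDescentTamePotSupersingularJetchevIrreducibleCebotarevScalar
import HarnessLib

/-!
# Crux `JetchevIrreducibleReadingByName` (item 20165): McCallum 1991 Cor. 3.2 at level `p^M` —
# Kolyvagin primes with PRESCRIBED local orders of independent eigenclasses — for ANY image with
# (Z) a non-trivial scalar realised by `Γ_K`, (S) `E[p]` simple, (C) scalar commutant; seat
# `bsd-potss-k8t-c4` g9; route-free; `--supports 20165`, helper; nothing booked, no item closed

Sequel of `…JetchevIrreducibleCebotarevScalar` (§1–§3). §4 here = the tree's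
`exists_kolyvaginPrime_gt_pow` / `McCallum1991_cor_3_2_pow_of_chebotarev` /
`McCallum1991.cor32_eigenclasses_infinite_primes_localOrder_holds` (Cor. 3.2 at level `p^M` from
Čebotarev + Weil pairing) re-run BYTE-FOR-BYTE with «`ρ̄_{E,p}` onto» replaced by exactly what the
proof consumes: (S) `E(K̄)[p]` simple `Γ_K`-module, (C) scalar `Γ_K`-commutant, (Z) some `z ∈ Γ_K`
acting on `E(K̄)[p]` as an integer scalar `a`, `p ∤ a - 1` (the surjective proof has `a = -1`):
`exists_kolyvaginPrime_gt_pow_of_image` (above every bound) and `cor32_pow_of_image` (printed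
hypotheses). = Jetchev 2008 Rem. 6.2's claim for his Lemma 5.1 (= [McC] Cor. 3.2) made precise.
The sequels `…JetchevIrreducibleCebotarevImage` / `…Irreducible` discharge (Z), (S), (C) from
`W.HasIrreducibleModPGaloisRep p` + Heegner hypothesis for `(N_E, K)` + `p ∣ N_E` and state the
`Set.Infinite` (named-fact) shape. HONEST FRAMING: re-plumbing of tree proofs under
weaker hypotheses; nothing asserted about any curve; crux 20165, its stubs and BSD stay open.

References: [cite: McCallumLMS1991, §3 Prop. 3.1, Cor. 3.2 (pp. 298–299), §4 (pp. 299–300)]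
[cite: GrossLMS1991, §3 (3.1)–(3.3), §9 Props. 9.1, 9.3] [cite: Jetchev2008, Lemma 5.1 (p. 821),
Rem. 6.2] [cite: WZhang2014, Notations (xii)] [cite: TateGCFT1967, §2.4].
-/


set_option autoImplicit false
-- the Theorems directory repeats the summit name (sibling precedent `KatoDescentPotSupersingularAssembly.lean`)
set_option linter.dupNamespace false

noncomputable section

open scoped Classical Pointwise
open WeierstrassCurve NumberField IsDedekindDomain Field
open Literature.NumberTheory.GaloisRepresentations Literature.NumberTheory.EllipticCurves

universe u v

namespace Summit.BirchSwinnertonDyer.BirchSwinnertonDyer.Theorems.JetchevIrreducibleCebotarev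

/-! ### §4. McCallum's Cor. 3.2 at level `p^M` for any image with (Z), (S), (C) -/

section Main

variable {W : WeierstrassCurve ℚ} {K : Type u} [Field K] [NumberField K]

/-- **A scalar on `E[p]` realised by `z ∈ Γ_K` lifts: `z^{p^{M-1}}` acts on `E[p^M]` as
`a^{p^{M-1}}`** (§1 for `A = E(K̄)`). [folklore] -/
theorem smul_pow_eq_smul_geomTorsion_pow {K : Type u} [Field K] (W : WeierstrassCurve K) {p : ℕ}
    (hp : p.Prime) {M : ℕ} (hM : 1 ≤ M) {z : absoluteGaloisGroup K} {a : ℤ} (ha : ¬ (p : ℤ) ∣ a)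
    (hz : ∀ P : geomTorsion W p, z • P = a • P) (P : geomTorsion W ((p ^ M : ℕ) : ℤ)) :
    z ^ p ^ (M - 1) • P = (a ^ p ^ (M - 1)) • P := by
  apply Subtype.ext
  rw [Literature.NumberTheory.EllipticCurves.AddSubgroup.torsionBy.coe_smul, AddSubgroupClass.coe_zsmul]
  refine smul_pow_eq_smul_of_smul_eq_smul_torsionBy hp ha (fun t ht ↦ ?_) hM ?_
  · have := hz ⟨t, (mem_geomTorsion_iff W _ t).mpr ht⟩
    have := congrArg (fun x : geomTorsion W p ↦ (x : geomPoints W)) this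
    simpa using this
  · have := (mem_geomTorsion_iff W _ (P : geomPoints W)).mp P.2
    exact_mod_cast this

/-- **McCallum 1991, Cor. 3.2 at level `p^M` above every bound, for ANY image with (S) `E(K̄)[p]`
simple, (C) scalar commutant, (Z) some `z ∈ Γ_K` acting as a scalar `a`, `p ∤ a - 1`** — the
tree's `exists_kolyvaginPrime_gt_pow` (McCallum Prop. 3.1 / Cor. 3.2, PDF pp. 279–280) line by line
with `hρ` (onto) replaced by (S), (C), (Z): (Z) replaces `-1` through `smul_pow_eq_smul_geomTorsion_pow`
(`z^{p^{M-1}}` is the scalar `a^{p^{M-1}}` on `E[p^M]`, `a^{p^{M-1}} - 1` invertible there) and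
`exists_h1Eval_conj_mul_order_of_smul_eq`. Other hypotheses/conclusion as printed there.
[cite: McCallumLMS1991, §3 Cor. 3.2 (proof, with Prop. 3.1)] [cite: Jetchev2008, Rem. 6.2] -/
theorem exists_kolyvaginPrime_gt_pow_of_image (hC : Literature.NumberTheory.Automorphic.chebotarev_artinRep) {N : ℕ} [NeZero N]
    [W.IsElliptic] (hK : IsImaginaryQuadratic K) {p : ℕ} (hp : p.Prime) (hp2 : p ≠ 2)
    (hS : ∀ H : AddSubgroup (geomTorsion (W.baseChange K) p),
      (∀ g : absoluteGaloisGroup K, ∀ t ∈ H, g • t ∈ H) → H = ⊥ ∨ H = ⊤)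
    (hCe : ∀ f : geomTorsion (W.baseChange K) p →+ geomTorsion (W.baseChange K) p,
      (∀ (g : absoluteGaloisGroup K) (t : geomTorsion (W.baseChange K) p), f (g • t) = g • f t) →
        ∃ k : ℤ, ∀ t, f t = k • t)
    {z : absoluteGaloisGroup K} {a : ℤ} (ha1 : ¬ (p : ℤ) ∣ a - 1)
    (hz : ∀ P : geomTorsion (W.baseChange K) p, z • P = a • P)
    (hW : W.exists_weilPairing p) {M : ℕ} (hM : 1 ≤ M)
    {c : K ≃ₐ[ℚ] K} (hc : c ≠ 1) {r : ℕ}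
    (cs : Fin r → galH1Torsion (W.baseChange K) ((p ^ M : ℕ) : ℤ))
    (hτ : ∀ i, ∃ e : ℤ, (e = 1 ∨ e = -1) ∧ conjAct W c ((p ^ M : ℕ) : ℤ) (cs i) = e • cs i)
    (ex : Fin r → ℕ) (hex : ∀ i, ((p : ℤ) ^ ex i) • cs i = 0)
    (hind : ∀ a : Fin r → ℤ, ∑ i, a i • cs i = 0 → ∀ i, ((p : ℤ) ^ ex i) ∣ a i)
    (Nv : Fin r → ℕ) (hNe : ∀ i, Nv i ≤ ex i) (hNM : ∀ i, Nv i ≤ M) (b : ℕ) :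
    ∃ ℓ : ℕ, b < ℓ ∧ ℓ.Prime ∧ ¬ ℓ ∣ N ∧ ¬ ((ℓ : ℤ) ∣ NumberField.discr K) ∧ ℓ ≠ p ∧
      (Ideal.span {(ℓ : 𝓞 K)}).IsPrime ∧ FrobEqFrobInfty W K (p ^ M) ℓ ∧
      ∀ i, ∀ v : HeightOneSpectrum (𝓞 K), (ℓ : 𝓞 K) ∈ v.asIdeal →
        (((p : ℤ) ^ Nv i) • cs i ∈
            (W.baseChange K).torsionLocalKer (v.adicCompletion K) ((p ^ M : ℕ) : ℤ) ∧
          (Nv i ≠ 0 → ((p : ℤ) ^ (Nv i - 1)) • cs i ∉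
            (W.baseChange K).torsionLocalKer (v.adicCompletion K) ((p ^ M : ℕ) : ℤ))) := by
  classical
  haveI : Fact p.Prime := ⟨hp⟩
  haveI : Algebra.IsQuadraticExtension ℚ K := ⟨hK.1⟩
  haveI : IsTotallyComplex K := hK.2
  have hp0 : (p : ℤ) ≠ 0 := by exact_mod_cast hp.ne_zero
  have hn0 : ((p ^ M : ℕ) : ℤ) ≠ 0 := by exact_mod_cast pow_ne_zero M hp.ne_zero
  have hpn : (p : ℤ) ∣ ((p ^ M : ℕ) : ℤ) := by
    rw [Nat.cast_pow]; exact dvd_pow_self _ (by omega)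
  have hodd : Odd p := hp.odd_of_ne_two hp2
  -- ### Step A: complex conjugation, the involutive lift, the image of `Γ_K` on `E_p`
  obtain ⟨c₀, hc₀⟩ := exists_isComplexConjugation (Rat.castHom ℝ)
  set t : AlgebraicClosure K ≃+* AlgebraicClosure K :=
    (absGaloisTransport (K := ℚ) (L := K) c₀).toRingEquiv with ht_def
  have ht : IsLiftOfAut c t :=
    RatClosure.isLiftOfAut_absGaloisTransport_of_isImaginaryQuadratic hK hc hc₀
  have hinv : ∀ x, t (t x) = x := fun x ↦
    RatClosure.absGaloisTransport_absGaloisTransport_of_sq_eq_one hc₀.sq_eq_one x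
  -- eigenvectors of `τ` on `E(K̄)[p]`, transported from `E(ℚ̄)[p]`
  obtain ⟨⟨vPlus, hvPlus0, hvPlus⟩, ⟨vMinus, hvMinus0, hvMinus⟩⟩ :=
    RatClosure.exists_eigenvectors W hc₀ hW hp2
  set θ := RatClosure.torsionEquiv (K := K) W p with hθ
  have hePlus : ht.torsionMap W p (θ vPlus) = θ vPlus := by
    rw [← RatClosure.torsionEquiv_smul_of_lift W ht c₀ (fun _ ↦ rfl) p vPlus, hvPlus]
  have heMinus : ht.torsionMap W p (θ vMinus) = -θ vMinus := by
    rw [← RatClosure.torsionEquiv_smul_of_lift W ht c₀ (fun _ ↦ rfl) p vMinus, hvMinus, map_neg]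
  have hPlus0 : θ vPlus ≠ 0 := fun h ↦ hvPlus0 (θ.injective (by rw [h, map_zero]))
  have hMinus0 : θ vMinus ≠ 0 := fun h ↦ hvMinus0 (θ.injective (by rw [h, map_zero]))
  -- ### Step A': the level-`p^M` inputs
  -- `a` is a unit mod `p` (it is the scalar of an automorphism of `E[p] ≠ 0`)
  have ha0 : ¬ (p : ℤ) ∣ a := by
    rintro ⟨c, hc⟩
    apply hPlus0
    have h1 : z • θ vPlus = 0 := by
      rw [hz, hc, mul_comm, mul_smul]
      have : (p : ℤ) • θ vPlus = 0 := Subtype.ext (by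
        rw [AddSubgroupClass.coe_zsmul, ZeroMemClass.coe_zero]
        exact (mem_geomTorsion_iff (W.baseChange K) _ _).mp (θ vPlus).2)
      rw [this, smul_zero]
    calc θ vPlus = z⁻¹ • z • θ vPlus := (inv_smul_smul z _).symm
      _ = 0 := by rw [h1, smul_zero]
  set a' : ℤ := a ^ p ^ (M - 1) with ha'
  have hz' : ∀ P : geomTorsion (W.baseChange K) ((p ^ M : ℕ) : ℤ), z ^ p ^ (M - 1) • P = a' • P :=
    smul_pow_eq_smul_geomTorsion_pow (W.baseChange K) hp hM ha0 hz
  -- `a' - 1` is invertible on `E[p^M]`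
  have ha1' : ¬ (p : ℤ) ∣ a' - 1 := fun h ↦ ha1 (by
    have h2 := prime_dvd_pow_prime_pow_sub hp a (M - 1)
    have : a - 1 = (a' - 1) - (a ^ p ^ (M - 1) - a) := by rw [ha']; ring
    rw [this]
    exact dvd_sub h h2)
  obtain ⟨m, w, hmw⟩ : IsCoprime (a' - 1) ((p : ℤ) ^ M) :=
    (((Nat.prime_iff_prime_int.mp hp).irreducible.coprime_iff_not_dvd.mpr ha1').symm).pow_right
  obtain ⟨u, hu⟩ := exists_two_mul_zsmul_eq_of_odd (W.baseChange K) (n := p ^ M) hodd.pow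
  obtain ⟨ePlus, hePlus', hPlus0'⟩ := ht.exists_eigenvector_pow W hinv hp hp2 hM (ν := 1)
    (Or.inl rfl) (e₁ := θ vPlus) (by rw [one_smul]; exact hePlus) hPlus0
  obtain ⟨eMinus, heMinus', hMinus0'⟩ := ht.exists_eigenvector_pow W hinv hp hp2 hM (ν := -1)
    (Or.inr rfl) (e₁ := θ vMinus) (by rw [neg_one_zsmul]; exact heMinus) hMinus0
  rw [one_smul] at hePlus'
  rw [neg_one_zsmul] at heMinus'
  have hkill : ∀ P : geomTorsion (W.baseChange K) ((p ^ M : ℕ) : ℤ), ((p : ℤ) ^ M) • P = 0 :=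
    fun P ↦ by
    apply Subtype.ext
    rw [AddSubgroupClass.coe_zsmul, ZeroMemClass.coe_zero]
    have := (mem_geomTorsion_iff (W.baseChange K) _ (P : geomPoints (W.baseChange K))).mp P.2
    exact_mod_cast this
  choose ν hν using hτ
  have hm : ∀ P : geomTorsion (W.baseChange K) ((p ^ M : ℕ) : ℤ), (m * (a' - 1)) • P = P := fun P ↦ by
    have : m * (a' - 1) = 1 - w * (p : ℤ) ^ M := by linear_combination hmw
    rw [this, sub_smul, one_smul, mul_smul, hkill, smul_zero, sub_zero]
  -- ### Step B: the choice of `ρ` (McCallum (2) and Prop. 3.1 at level `p^M`)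
  obtain ⟨ρ, hρT, hρ⟩ := exists_h1Eval_conj_mul_order_of_smul_eq W ht hinv hp hpn hS hCe hz' hm hu
    hePlus' heMinus' (hkill ePlus) (hkill eMinus) hPlus0' hMinus0' (fun i ↦ (hν i).1)
    (fun i ↦ (hν i).2) ex hex hind Nv hNe hNM
  -- ### Step C: the finite exceptional set of places of `ℚ`
  have hbad : ((W.baseChange K).badPlaces (𝓞 K)).Finite :=
    (W.baseChange K).finite_badPlaces_holds (𝓞 K)
  choose T hTfin hT using fun i ↦
    exists_finite_forall_mem_unramifiedKer (W.baseChange K) hn0 (cs i)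
  set B : Finset ℕ := {p} ∪ N.primeFactors ∪ (NumberField.discr K).natAbs.primeFactors ∪
    Finset.range (b + 1) with hB
  set S₁ : Set (HeightOneSpectrum (𝓞 ℚ)) := {v | ∃ q ∈ B, q.Prime ∧ (q : 𝓞 ℚ) ∈ v.asIdeal}
    with hS₁
  set S₂ : Set (HeightOneSpectrum (𝓞 ℚ)) := {v | ¬ Algebra.IsUnramifiedIn (𝓞 K) v.asIdeal}
    with hS₂
  set S₃ : Set (HeightOneSpectrum (𝓞 ℚ)) :=
    (fun w : HeightOneSpectrum (𝓞 K) ↦ w.under (𝓞 ℚ)) ''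
      ((W.baseChange K).badPlaces (𝓞 K) ∪ ⋃ i, T i) with hS₃
  have hS₁fin : S₁.Finite := by
    have : S₁ ⊆ ⋃ q ∈ (B.filter Nat.Prime), {v | (q : 𝓞 ℚ) ∈ v.asIdeal} := by
      intro v ⟨q, hqB, hq, hqv⟩
      simp only [Set.mem_iUnion, Finset.mem_filter]
      exact ⟨q, ⟨hqB, hq⟩, hqv⟩
    refine Set.Finite.subset (Set.Finite.biUnion (Finset.finite_toSet _) fun q hq ↦ ?_) this
    rw [Finset.coe_filter, Set.mem_setOf_eq] at hq
    have hsub : {v : HeightOneSpectrum (𝓞 ℚ) | (q : 𝓞 ℚ) ∈ v.asIdeal}.Subsingleton :=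
      fun v hv v' hv' ↦ HeightOneSpectrum.eq_of_natCast_mem_rat hq.2 hv hv'
    exact hsub.finite
  have hS₂fin : S₂.Finite := finite_setOf_not_isUnramifiedIn ℚ K
  have hS₃fin : S₃.Finite :=
    (hbad.union (Set.finite_iUnion fun i ↦ hTfin i)).image _
  set S := S₁ ∪ S₂ ∪ S₃ with hSdef
  have hSfin : S.Finite := (hS₁fin.union hS₂fin).union hS₃fin
  -- ### Step D: Čebotarev in `Γ_ℚ`: a Frobenius in the open set `c₀ · res(ρ 𝒩)`
  set 𝒩 := evalKer (W.baseChange K) ((p ^ M : ℕ) : ℤ) cs with h𝒩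
  have h𝒩open : IsOpen (𝒩 : Set (absoluteGaloisGroup K)) :=
    isOpen_evalKer (W.baseChange K) _ cs (isOpen_torsionFixing (W.baseChange K) hn0)
  set O : Set (absoluteGaloisGroup ℚ) :=
    (fun γ ↦ c₀ * γ) '' (absGaloisRestrict ℚ K '' ((fun m ↦ ρ * m) '' (𝒩 : Set _))) with hO
  have hOopen : IsOpen O := by
    refine (Homeomorph.mulLeft c₀).isOpenMap _ (isOpenMap_absGaloisRestrict K _ ?_)
    exact (Homeomorph.mulLeft ρ).isOpenMap _ h𝒩open
  have hOne : O.Nonempty :=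
    ⟨c₀ * absGaloisRestrict ℚ K (ρ * 1), _, ⟨_, ⟨1, 𝒩.one_mem, rfl⟩, rfl⟩, rfl⟩
  obtain ⟨γ, hγO, v, hvS, 𝔓₀, h𝔓₀, hγ⟩ :=
    (absoluteGaloisGroup.frobenius_dense hC ℚ S hSfin).inter_open_nonempty O hOopen hOne
  obtain ⟨_, ⟨_, ⟨m, hm, rfl⟩, rfl⟩, rfl⟩ := hγO
  set g := ρ * m with hg
  have hgT : g ∈ torsionFixing (W.baseChange K) ((p ^ M : ℕ) : ℤ) := mul_mem hρT hm.1
  -- ### Step E: the rational prime `ℓ` under `v`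
  obtain ⟨ℓ, hℓ, hℓv⟩ := exists_prime_natCast_mem v
  have hℓB : ℓ ∉ B := fun h ↦ hvS (Or.inl (Or.inl ⟨ℓ, h, hℓ, hℓv⟩))
  simp only [hB, Finset.mem_union, Finset.mem_singleton, Nat.mem_primeFactors,
    Finset.mem_range, not_or] at hℓB
  obtain ⟨⟨⟨hℓp, hℓN⟩, hℓD⟩, hℓb⟩ := hℓB
  have hℓN' : ¬ ℓ ∣ N := fun h ↦ hℓN ⟨hℓ, h, NeZero.ne N⟩
  have hℓD' : ¬ ((ℓ : ℤ) ∣ NumberField.discr K) := fun h ↦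
    hℓD ⟨hℓ, Int.natAbs_dvd_natAbs.mpr h |>.trans (by simp), by
      simp [NumberField.discr_ne_zero]⟩
  have hbℓ : b < ℓ := by omega
  have hunr : Algebra.IsUnramifiedIn (𝓞 K) v.asIdeal := by
    by_contra h; exact hvS (Or.inl (Or.inr h))
  have hvS₃ : v ∉ S₃ := fun h ↦ hvS (Or.inr h)
  -- ### Step F: `ℓ` is inert, with a Frobenius `τ' = g^τ g` over `K`
  have hHi := index_range_absGaloisRestrict_eq_finrank ℚ K
  haveI hHn : ((absGaloisRestrict ℚ K).range).Normal :=
    Subgroup.normal_of_index_eq_two (hHi.trans hK.1)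
  have hI := inertia_le_range_absGaloisRestrict_of_isUnramifiedIn (K := K) hunr h𝔓₀
  have hΦH : c₀ * absGaloisRestrict ℚ K g ∉ (absGaloisRestrict ℚ K).range := by
    intro h
    apply hc₀.not_mem_range_absGaloisRestrict (L := K) IsTotallyComplex.isComplex
    change c₀ ∈ ((absGaloisRestrict ℚ K).range : Set (absoluteGaloisGroup ℚ))
    have h' : c₀ = c₀ * absGaloisRestrict ℚ K g * (absGaloisRestrict ℚ K g)⁻¹ := by group
    rw [SetLike.mem_coe, h']
    exact Subgroup.mul_mem _ h (Subgroup.inv_mem _ ⟨g, rfl⟩)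
  obtain ⟨w, 𝔔, τ', hwv, hwuniq, -, h𝔔w, -, hτ', hresτ'⟩ :=
    exists_place_inert_of_not_mem_range (F := ℚ) (M := K) (hK.1 ▸ Nat.prime_two) hHn
      (hHi.trans rfl) hunr h𝔓₀ hI hγ hΦH
  rw [hK.1, sq_eq_absGaloisRestrict_conjGal_mul hc₀ ht g] at hresτ'
  have hτ'eq : τ' = ht.conjGalCMH g * g := absGaloisRestrict_injective ℚ K hresτ'
  -- `ℓ ∈ w`, and `w` is the only place of `K` containing `ℓ`
  have hℓw : (ℓ : 𝓞 K) ∈ w.asIdeal := by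
    have h1 : (ℓ : 𝓞 ℚ) ∈ (w.under (𝓞 ℚ)).asIdeal := by rw [hwv]; exact hℓv
    rw [HeightOneSpectrum.under_asIdeal, Ideal.under_def, Ideal.mem_comap, map_natCast] at h1
    exact h1
  have hwuniq' : ∀ w' : HeightOneSpectrum (𝓞 K), (ℓ : 𝓞 K) ∈ w'.asIdeal → w' = w := by
    intro w' hw'
    apply hwuniq
    apply HeightOneSpectrum.eq_of_natCast_mem_rat hℓ _ hℓv
    rw [HeightOneSpectrum.under_asIdeal, Ideal.under_def, Ideal.mem_comap, map_natCast]
    exact hw'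
  -- `(ℓ) = w` is prime
  have hspan : Ideal.span {(ℓ : 𝓞 K)} = w.asIdeal := by
    apply span_natCast_eq_of_unique hℓ w hwuniq'
    haveI : w.asIdeal.LiesOver v.asIdeal := ⟨by rw [← hwv]; rfl⟩
    have hmap : v.asIdeal.map (algebraMap (𝓞 ℚ) (𝓞 K)) = Ideal.span {(ℓ : 𝓞 K)} := by
      rw [← span_natCast_rat_eq hℓ hℓv, Ideal.map_span, Set.image_singleton, map_natCast]
    have hne : v.asIdeal.map (algebraMap (𝓞 ℚ) (𝓞 K)) ≠ ⊥ := by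
      rw [hmap, Ne, Ideal.span_singleton_eq_bot]; exact_mod_cast hℓ.ne_zero
    rw [← hmap, ← Ideal.IsDedekindDomain.ramificationIdx_eq_normalizedFactors_count v.asIdeal
      w.asIdeal hne]
    exact Ideal.ramificationIdx_eq_one_iff.mpr (hunr w.asIdeal w.isPrime inferInstance)
  -- ### Step G: the local criterion at `w`, for the classes `p^a c_i`
  have hloc : ∀ i (a : ℕ), (((p : ℤ) ^ a) • cs i ∈
      (W.baseChange K).torsionLocalKer (w.adicCompletion K) ((p ^ M : ℕ) : ℤ) ↔
        ((p : ℤ) ^ a) • h1Eval (W.baseChange K) ((p ^ M : ℕ) : ℤ) (cs i)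
          (ht.conjGalCMH (ρ * m) * (ρ * m)) = 0) := by
    intro i a
    haveI : CharZero (w.adicCompletion K) :=
      charZero_of_injective_algebraMap (algebraMap K (w.adicCompletion K)).injective
    obtain ⟨𝔐, h𝔐⟩ := w.localPrimesAbove_nonempty
    set 𝔓w := w.primeBelow (closureEmb (K := K) (w.adicCompletion K)) 𝔐 with h𝔓w_def
    have h𝔓w : 𝔓w ∈ w.primesAbove := w.primeBelow_mem_primesAbove h𝔐
    obtain ⟨δ, hδ, hF⟩ :=
      HeightOneSpectrum.exists_isArithFrobAt_conj_of_mem_primesAbove_holds h𝔔w h𝔓w hτ'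
    have hτ'T : τ' ∈ torsionFixing (W.baseChange K) ((p ^ M : ℕ) : ℤ) := by
      rw [hτ'eq]; exact mul_mem (ht.conjGalCMH_mem_torsionFixing W hinv _ hgT) hgT
    have hFT : δ * τ' * δ⁻¹ ∈ torsionFixing (W.baseChange K) ((p ^ M : ℕ) : ℤ) :=
      (torsionFixing_normal (W.baseChange K) _).conj_mem _ hτ'T δ
    have hwbad : w ∉ (W.baseChange K).badPlaces (𝓞 K) := fun h ↦
      hvS₃ ⟨w, Or.inl h, hwv⟩
    have hwT : w ∉ T i := fun h ↦ hvS₃ ⟨w, Or.inr (Set.mem_iUnion.mpr ⟨i, h⟩), hwv⟩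
    have hpw : ((p : ℤ) : 𝓞 K) ∉ w.asIdeal := by
      rw [Int.cast_natCast]
      exact not_natCast_mem_of_prime_ne hℓ hp hℓp w hℓw
    have hpMw : ((((p ^ M : ℕ) : ℤ)) : 𝓞 K) ∉ w.asIdeal := fun h ↦ by
      apply hpw
      rw [Int.cast_natCast, Nat.cast_pow] at h
      rw [Int.cast_natCast]
      exact w.isPrime.mem_of_pow_mem M h
    have hcrit := mem_torsionLocalKer_iff_h1Eval_eq_zero (W.baseChange K) ((p ^ M : ℕ) : ℤ) h𝔐 hF
      hFT (inertia_le_torsionFixing (W.baseChange K) hwbad hpMw _ h𝔐)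
      (isOpen_torsionFixing (W.baseChange K) hn0)
      (torsionPointsMap_bijective (W.baseChange K) (w.adicCompletion K)
        (pow_ne_zero M hp.ne_zero)).2
      (AddSubgroup.zsmul_mem _ (hT i w hwT 𝔓w h𝔓w) ((p : ℤ) ^ a))
    rw [hcrit, h1Eval_conj (W.baseChange K) _ _ δ hτ'T, smul_eq_zero_iff_eq,
      h1Eval_zsmul (W.baseChange K) _ _ _ hτ'T, hτ'eq]
  -- ### Step H: assemble
  refine ⟨ℓ, hbℓ, hℓ, hℓN', hℓD', hℓp, hspan ▸ w.isPrime, ?_, fun i v' hv' ↦ ?_⟩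
  · -- Cor. 3.2 (1): `γ = c₀ · res g` acts on `E(ℚ̄)[p^M]` and on `K` as `c₀`
    refine ⟨v, 𝔓₀, c₀ * absGaloisRestrict ℚ K g, c₀, hℓv, h𝔓₀, hγ, hc₀, fun P ↦ ?_, fun e x ↦ ?_⟩
    · rw [mul_smul, absGaloisRestrict_smul_eq_of_mem_torsionFixing W hgT]
    · rw [mul_smul, absGaloisRestrict_smul_apply_eq g e x]
  · rw [hwuniq' v' hv']
    refine ⟨(hloc i (Nv i)).mpr (hρ m hm i).1, fun hN h ↦ (hρ m hm i).2 hN ((hloc i _).mp h)⟩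



/-- **McCallum 1991, Cor. 3.2 at level `p^M` with the printed hypotheses, for any image with
(Z), (S), (C)**: non-zero eigenclasses, independence as *"`ord c_i` divides `a_i`"* (`a_i c_i = 0`),
`N_i ≤ M_i` (as `p^{N_i-1} c_i ≠ 0`); = the tree's `McCallum1991_cor_3_2_pow_of_chebotarev` with
`hρ` replaced by the three image hypotheses. [cite: McCallumLMS1991, §3 Cor. 3.2 (with Prop. 3.1)] -/
theorem cor32_pow_of_image (hC : Literature.NumberTheory.Automorphic.chebotarev_artinRep) {N : ℕ}
    [NeZero N] [W.IsElliptic] (hK : IsImaginaryQuadratic K) {p : ℕ} (hp : p.Prime) (hp2 : p ≠ 2)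
    (hS : ∀ H : AddSubgroup (geomTorsion (W.baseChange K) p),
      (∀ g : absoluteGaloisGroup K, ∀ t ∈ H, g • t ∈ H) → H = ⊥ ∨ H = ⊤)
    (hCe : ∀ f : geomTorsion (W.baseChange K) p →+ geomTorsion (W.baseChange K) p,
      (∀ (g : absoluteGaloisGroup K) (t : geomTorsion (W.baseChange K) p), f (g • t) = g • f t) →
        ∃ k : ℤ, ∀ t, f t = k • t)
    {z : absoluteGaloisGroup K} {a : ℤ} (ha1 : ¬ (p : ℤ) ∣ a - 1)
    (hz : ∀ P : geomTorsion (W.baseChange K) p, z • P = a • P)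
    (hW : W.exists_weilPairing p) {M : ℕ} (hM : 1 ≤ M)
    {c : K ≃ₐ[ℚ] K} (hc : c ≠ 1) {r : ℕ}
    (cs : Fin r → galH1Torsion (W.baseChange K) ((p ^ M : ℕ) : ℤ)) (h0 : ∀ i, cs i ≠ 0)
    (Nv : Fin r → ℕ) (hN : ∀ i, Nv i ≠ 0 → ((p : ℤ) ^ (Nv i - 1)) • cs i ≠ 0)
    (hτ : ∀ i, ∃ e : ℤ, (e = 1 ∨ e = -1) ∧ conjAct W c ((p ^ M : ℕ) : ℤ) (cs i) = e • cs i)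
    (hind : ∀ a : Fin r → ℤ, ∑ i, a i • cs i = 0 → ∀ i, a i • cs i = 0) (b : ℕ) :
    ∃ ℓ : ℕ, b < ℓ ∧ IsKolyvaginPrime N W K p ℓ ∧ FrobEqFrobInfty W K (p ^ M) ℓ ∧
      ∀ i, ∀ v : HeightOneSpectrum (𝓞 K), (ℓ : 𝓞 K) ∈ v.asIdeal →
        (((p : ℤ) ^ Nv i) • cs i ∈
            (W.baseChange K).torsionLocalKer (v.adicCompletion K) ((p ^ M : ℕ) : ℤ) ∧
          (Nv i ≠ 0 → ((p : ℤ) ^ (Nv i - 1)) • cs i ∉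
            (W.baseChange K).torsionLocalKer (v.adicCompletion K) ((p ^ M : ℕ) : ℤ))) := by
  -- exponents `p^{e_i} = ord c_i`
  choose ex hex1 hexM hex hexmin hord using fun i ↦
    exists_addOrderOf_eq_pow (W.baseChange K) hp M (hx := h0 i)
  have hind' : ∀ a : Fin r → ℤ, ∑ i, a i • cs i = 0 → ∀ i, ((p : ℤ) ^ ex i) ∣ a i := by
    intro a ha i
    have h := (addOrderOf_dvd_iff_zsmul_eq_zero).mpr (hind a ha i)
    rwa [hord i, Nat.cast_pow] at h
  have hNe : ∀ i, Nv i ≤ ex i := fun i ↦ by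
    by_contra hlt
    have hlt := Nat.lt_of_not_le hlt
    have hk : ((p : ℤ) ^ (Nv i - 1)) • cs i = 0 := by
      have : Nv i - 1 = (Nv i - 1 - ex i) + ex i := by omega
      rw [this, pow_add, mul_smul, hex i]
      exact zsmul_zero _
    exact hN i (by omega) hk
  have hNM : ∀ i, Nv i ≤ M := fun i ↦ (hNe i).trans (hexM i)
  obtain ⟨ℓ, hbℓ, hℓ, hℓN, hℓD, hℓp, hprime, hfrob, hloc⟩ :=
    exists_kolyvaginPrime_gt_pow_of_image (N := N) hC hK hp hp2 hS hCe ha1 hz hW hM hc cs hτ ex hex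
      hind' Nv hNe hNM b
  exact ⟨ℓ, hbℓ, ⟨hℓ, hℓN, hℓD, hℓp, hprime, hfrob.of_dvd (dvd_pow_self p (by omega))⟩, hfrob, hloc⟩


end Main

end Summit.BirchSwinnertonDyer.BirchSwinnertonDyer.Theorems.JetchevIrreducibleCebotarev

end
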